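import Mathlib

/-!
# The junction step of an INERTIA-3L certificate: completing the square across the head∣tail boundary (instab3 g7, cell `ns-blowup`, 2026-08-27)

HONEST FRAMING (human ruling D-0035): nothing here is a claim about Navier–Stokes blow-up.
WHAT THIS IS NOT: not NS evidence. FORMAT lemma (finite-dimensional, real) for the certificates of
`HOME/instab3/PREREG-INERTIA-3L.md` / INSTAB3-METHOD §14.2 (MODEL: the forced-ABC linearisation restricted to one
symmetry class; companion of `Summit.NavierStokesRegularity.FluidComputer.LyapunovInertiaCount`, p493094).

The certificate verifies, on the finite head `H`, that the matrix
`𝓜 := M₀ + ½ · F₂ · diag(E)⁻¹ · F₂ᵀ` is negative definite, where `M₀` is the weighted head form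
(`G_H Â_HH + Â_HHᵀ G_H`), `F₂ = T_HB + T_BHᵀ` collects the (strain) couplings from the head to the first tail shell `B`,
and `E_i = ν|k_i|² + a − s > 0` are the tail dissipation constants. The analytic tail estimate (kernel pairing bound,
`AbcLatticePairingBound`) reduces the full weighted form `2 Re⟪G w, (L − a) w⟫` to
`w_Hᵀ M₀ w_H + 2 w_Hᵀ F₂ w_B − 2 Σ_B E_i w_{B,i}² − (deeper tail terms ≤ 0)`; this file proves the elementary step
that turns `𝓜 ≺ 0` into strict negativity of that expression for every `(w_H, w_B) ≠ 0`:

* `junction_square` — `2 Σ cᵢyᵢ − 2 Σ Eᵢyᵢ² ≤ ½ Σ cᵢ²/Eᵢ` for `E > 0` (maximise the concave quadratic in `y`);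
* `dotProduct_corr_mulVec` — `wᵀ(F₂ diag(E⁻¹) F₂ᵀ)w = Σ (F₂ᵀw)ᵢ²/Eᵢ`;
* `head_boundary_form_neg` — `𝓜 ≺ 0` (as `∀ w ≠ 0, wᵀ𝓜w < 0`) and `E > 0` ⇒ for all `(w_H, w_B) ≠ (0,0)`:
  `w_Hᵀ M₀ w_H + 2 w_Hᵀ F₂ w_B − 2 Σ Eᵢ w_{B,i}² < 0`.

Mathlib only; no new definitions; std axioms.
-/

namespace Summit.NavierStokesRegularity.FluidComputer.InertiaJunctionSquare

open Matrix Finset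

variable {H B : Type*} [Fintype H] [Fintype B] [DecidableEq B]

omit [DecidableEq B] in
/-- **Completing the square across the junction.** For `E > 0`:
`2 Σ cᵢ yᵢ − 2 Σ Eᵢ yᵢ² ≤ ½ Σ cᵢ² / Eᵢ` (the maximum over `y` of the concave quadratic, attained at `yᵢ = cᵢ/(2Eᵢ)`). -/
theorem junction_square (c y E : B → ℝ) (hE : ∀ i, 0 < E i) :
    2 * ∑ i, c i * y i - 2 * ∑ i, E i * y i ^ 2 ≤ (1 / 2) * ∑ i, c i ^ 2 / E i := by
  rw [Finset.mul_sum, Finset.mul_sum, Finset.mul_sum, ← Finset.sum_sub_distrib]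
  apply Finset.sum_le_sum
  intro i _
  have hEi := hE i
  set d : ℝ := c i / E i with hd
  have hc : c i = d * E i := by rw [hd, div_mul_cancel₀ _ hEi.ne']
  have h1 : c i ^ 2 / E i = d ^ 2 * E i := by
    rw [hc]; field_simp
  rw [h1, hc]
  nlinarith [sq_nonneg (d - 2 * y i), hEi, mul_nonneg hEi.le (sq_nonneg (d - 2 * y i))]

/-- The correction term as a sum of squares: `wᵀ (F₂ · diag(E⁻¹) · F₂ᵀ) w = Σᵢ (F₂ᵀ w)ᵢ² / Eᵢ`. -/
theorem dotProduct_corr_mulVec (F2 : Matrix H B ℝ) (E : B → ℝ) (w : H → ℝ) :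
    w ⬝ᵥ ((F2 * Matrix.diagonal (fun i => (E i)⁻¹) * F2ᵀ) *ᵥ w) =
      ∑ i, (F2ᵀ *ᵥ w) i ^ 2 / E i := by
  rw [← Matrix.mulVec_mulVec, ← Matrix.mulVec_mulVec, Matrix.dotProduct_mulVec]
  -- now: (w ᵥ* F2) ⬝ᵥ (diagonal _ *ᵥ (F2ᵀ *ᵥ w)) with w ᵥ* F2 = F2ᵀ *ᵥ w
  have hv : w ᵥ* F2 = F2ᵀ *ᵥ w := (Matrix.mulVec_transpose F2 w).symm
  rw [hv]
  simp only [dotProduct, Matrix.mulVec_diagonal]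
  refine Finset.sum_congr rfl fun i _ => ?_
  rw [div_eq_mul_inv]; ring

/-- **The junction step.** If the certificate matrix `𝓜 = M₀ + ½ F₂ diag(E⁻¹) F₂ᵀ` is negative definite on the head
and the tail constants are positive, then the head∣boundary form is strictly negative for every `(w_H, w_B) ≠ (0, 0)`:
`w_Hᵀ M₀ w_H + 2 w_Hᵀ F₂ w_B − 2 Σ Eᵢ w_{B,i}² < 0`. -/
theorem head_boundary_form_neg (M0 : Matrix H H ℝ) (F2 : Matrix H B ℝ) (E : B → ℝ) (hE : ∀ i, 0 < E i)
    (hneg : ∀ w : H → ℝ, w ≠ 0 →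
      w ⬝ᵥ ((M0 + (1 / 2 : ℝ) • (F2 * Matrix.diagonal (fun i => (E i)⁻¹) * F2ᵀ)) *ᵥ w) < 0)
    (wH : H → ℝ) (wB : B → ℝ) (hw : wH ≠ 0 ∨ wB ≠ 0) :
    wH ⬝ᵥ (M0 *ᵥ wH) + 2 * (wH ⬝ᵥ (F2 *ᵥ wB)) - 2 * ∑ i, E i * wB i ^ 2 < 0 := by
  -- the cross term as `c ⬝ᵥ wB` with `c = F₂ᵀ w_H`
  set c : B → ℝ := F2ᵀ *ᵥ wH with hc
  have hcross : wH ⬝ᵥ (F2 *ᵥ wB) = ∑ i, c i * wB i := by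
    rw [Matrix.dotProduct_mulVec, hc]
    have : wH ᵥ* F2 = F2ᵀ *ᵥ wH := (Matrix.mulVec_transpose F2 wH).symm
    rw [this]; rfl
  have hsq := junction_square c wB E hE
  by_cases hH : wH = 0
  · -- pure boundary vector: the dissipation alone is negative
    have hB : wB ≠ 0 := hw.resolve_left (not_not.mpr hH)
    obtain ⟨j, hj⟩ : ∃ j, wB j ≠ 0 := by
      by_contra h
      push Not at h
      exact hB (funext h)
    have hpos : 0 < ∑ i, E i * wB i ^ 2 := by
      apply Finset.sum_pos'
      · intro i _; exact mul_nonneg (hE i).le (sq_nonneg _)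
      · exact ⟨j, Finset.mem_univ j, mul_pos (hE j) (by positivity)⟩
    subst hH
    simp only [dotProduct_zero, Matrix.mulVec_zero, zero_dotProduct, mul_zero, zero_add]
    linarith
  · have hM := hneg wH hH
    rw [Matrix.add_mulVec, dotProduct_add, Matrix.smul_mulVec, dotProduct_smul, smul_eq_mul,
      dotProduct_corr_mulVec] at hM
    -- hM : wHᵀ M₀ wH + ½ Σ cᵢ²/Eᵢ < 0 ; hsq : 2 Σ cᵢ wBᵢ − 2 Σ Eᵢ wBᵢ² ≤ ½ Σ cᵢ²/Eᵢ
    rw [hcross]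
    have : ∑ i, (F2ᵀ *ᵥ wH) i ^ 2 / E i = ∑ i, c i ^ 2 / E i := by rw [hc]
    rw [this] at hM
    linarith

end Summit.NavierStokesRegularity.FluidComputer.InertiaJunctionSquare
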